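import Summits.ResolutionOfSingularities.ResolutionOfSingularities.Theorems.WeightedInvariantJOpenPresentationLE3AssemblyPair
import Summits.ResolutionOfSingularities.ResolutionOfSingularities.Theorems.WeightedInvariantJOpenPresentationDivisorial
import Summits.ResolutionOfSingularities.ResolutionOfSingularities.Theorems.WeightedInvariantJOpenPresentationCurve
import Summits.ResolutionOfSingularities.ResolutionOfSingularities.Theorems.WeightedInvariantJFlatEssSmoothAssembly
import Summits.ResolutionOfSingularities.ResolutionOfSingularities.Theorems.WeightedInvariantHypersurfaceLocalGameEFT4SDimLETwoDimOne
import Literature.AlgebraicGeometry.Resolution.StrictNormalCrossingsAt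
import HarnessLib

/-!
# (open″)≤3 for the pair of record `(ι₃ᵗ, J₃ᵗ) = (Iota3.iotaFlatT, Iota3.jFlatT)` — THE REGIME ASSEMBLY:
# `JOpenPresentationForallSingLE 3 p iotaFlatT jFlatT` from (T) tie-freeness along height-two strata and the three POINT bodies
# (def-free form: the inputs are spelled out; the named form over `…JOpenPresentationLE3Defs` is a one-line corollary)
# (door `HypersurfaceCentreConstruction`, stmt-ResolutionOfSingularities-19897; P3 rung clause h8; DEAL (o52) SPLIT of
# res-L1-w43-plan-1 2026-08-27T15:54:33Z, part (o52-asm), hand res-D-brk-1)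

Topic: `Summits/ResolutionOfSingularities/ResolutionOfSingularities/Theorems`. Helper for the door item
`HypersurfaceCentreConstruction` (stmt-ResolutionOfSingularities-19897, route `WeightedInvariant`), line `local-engine`
(L W4.3), def-free.  THE ASSEMBLY THEOREM `jOpenPresentationForallSingLE_three_of_bodies`:

    (T) → (P₀₀) → (P₀₁) → (P₁₀) → JOpenPresentationForallSingLE 3 p iotaFlatT jFlatT,

with the four inputs SPELLED OUT (their named forms `JOpenLE3.TieFreeAlongCurveLE3 p`, `JOpenLE3.PointBodyLE3 p e t` live in the
definition module `…JOpenPresentationLE3Defs`, res-D-brk-1, review-queued at the time of filing; the named corollary follows it):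
(T) along a height-two equimultiple stratum `V(𝔭)` through a non-tie position some `D(h) ∋ 𝔪` carries no tie prime `𝔮 ⊇ 𝔭` of local
dimension `≤ 3`; (P_{e,t}) the literal body at every position of dimension `3` whose top `ι₀`-stratum is the closed point, with
`(ε, τ) = (e, t) ∈ {(0,0) ISOLATED, (0,1) TIE, (1,0) CROSSING}`.

At a model position `(A, 𝔪, F)` (`k₀` perfect of characteristic `p`, `A` of finite type, `S := A_𝔪` regular of dimension `≤ 3`,
`0 ≠ f := F/1 ∈ 𝔪_S²`) let `P₀ := topStratumPrime iotaOrdEpsTau S f` (prime, `S ⧸ P₀` regular: res-type-013's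
`topStratumPrime_iotaOrdEpsTau_spec`) and choose generators `u : Fin c → S` of `P₀` with independent differentials (Literature
`exists_span_eq_of_isRegularLocalRing_quotient`), so `c = ht P₀`:
* `c = 1` — MONOMIAL TYPE (the order is kept at the height-one prime `P₀ ∋ f`: tree
  `exists_eq_unit_mul_pow_of_iotaOrd_localization_eq_of_height_eq_one`) ⇒ res-D-brk-1's `jOpenPresentationLE_body_monomial` (p551867);
* `c = 2` — CURVE TYPE: `P₀ = (u₀, u₁)`; LEMMA M (res-L1-w43-stub-3) ⇒ `f` not of monomial type at `S_{P₀}`; the valuation dichotomy of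
  `S ⧸ P₀` (a field or a discrete valuation ring) and res-D-brk-1's MAXIMISER DESCENT core `Descent.exists_pair_reaches` ⇒ a regular
  pair `(x', g')` of `S` generating `P₀` with `g'` reaching `b_max` at `S_{P₀}`; numerators `x, g ∈ A`; transport to `A_𝔭`
  (`𝔭 = P₀ ∩ A`, `(A_𝔪)_{P₀} ≃ A_𝔭`); the ORDER form of the regime (off tie and crossing positions the top `ι₀`-stratum is the
  equimultiple locus); then res-D-brk-1's `jOpenPresentationLE_body_curve` (p552753) with (T);
* `c = 3` — POINT TYPE: `P₀ = 𝔪_S`, `dim S = 3`; by `(ε, τ) ∈ {(0,0), (0,1), (1,0)}` the inputs (P); `(1,1)` is vacuous.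

[OURS · L1 W4.3 · (o52-asm)]  Replaces the role of NO printed item; NOT a statement of the manuscript
[claim: Hironaka2017, status: under-review]. AI work, weaker than expert review.  Pure commutative algebra; no named facts.

## References

* H. Matsumura, *Commutative Ring Theory* (1987), Thm. 14.2 / 14.3 (regular parameters), Thm. 4.3 (primes of a localisation).
  [Matsumura1987]
* res-L1-w43-plan-1, IOTA3-DESIGN v1.3 §8.4 and DEAL (o52) SPLIT (OURS, AI planning).
-/

noncomputable section

open IsLocalRing Literature.AlgebraicGeometry.Resolution
open Summit.ResolutionOfSingularities.ResolutionOfSingularities.Cruxes.HypersurfaceCentreConstruction.LocalEngine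
open Summit.ResolutionOfSingularities.ResolutionOfSingularities.Cruxes.HypersurfaceCentreConstruction.LocalEngine.Iota3

set_option linter.dupNamespace false -- mandated namespace of this single-conjunct summit

namespace Summit.ResolutionOfSingularities.ResolutionOfSingularities.Theorems

namespace JOpenLE3

open ContactCylinder

/-! ## The assembly -/

/-- **(open″)≤3 FOR THE PAIR OF RECORD, ASSEMBLED FROM THE REGIME BODIES** (inputs spelled out): `JOpenPresentationForallSingLE 3 p
iotaFlatT jFlatT` from (T) tie-freeness along height-two equimultiple strata and the three point bodies (P₀₀) ISOLATED, (P₀₁) TIE,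
(P₁₀) CROSSING at dimension-3 positions whose top `ι₀`-stratum is the closed point; the height-one and height-two regimes are
res-D-brk-1's `jOpenPresentationLE_body_monomial` and `jOpenPresentationLE_body_curve`. [OURS · L1 W4.3 · (o52-asm)] -/
theorem jOpenPresentationForallSingLE_three_of (p : ℕ)
    (hT : ∀ (k₀ : Type) [Field k₀] [CharP k₀ p] [PerfectField k₀]
      (A : Type) [CommRing A] [Algebra k₀ A] [Algebra.FiniteType k₀ A] (𝔪 : Ideal A) [𝔪.IsPrime] (F : A)
      (𝔭 : Ideal A) [𝔭.IsPrime], 𝔭 ≤ 𝔪 →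
      IsRegularLocalRing (Localization.AtPrime 𝔪) →
      ringKrullDim (Localization.AtPrime 𝔪) ≤ (3 : ℕ) →
      algebraMap A (Localization.AtPrime 𝔪) F ≠ 0 →
      algebraMap A (Localization.AtPrime 𝔪) F ∈ (maximalIdeal (Localization.AtPrime 𝔪)) ^ 2 →
      ringKrullDim (Localization.AtPrime 𝔭) = (2 : ℕ) →
      topStratum iotaOrd (Localization.AtPrime 𝔪) (algebraMap A (Localization.AtPrime 𝔪) F) =
        {𝔮 | 𝔭.map (algebraMap A (Localization.AtPrime 𝔪)) ≤ 𝔮.asIdeal} →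
      ¬ IsTiePosition (Localization.AtPrime 𝔪) (algebraMap A (Localization.AtPrime 𝔪) F) →
      ∃ h : A, h ∉ 𝔪 ∧ ∀ (𝔮 : Ideal A) [𝔮.IsPrime], h ∉ 𝔮 → 𝔭 ≤ 𝔮 → ringKrullDim (Localization.AtPrime 𝔮) ≤ (3 : ℕ) →
        ¬ IsTiePosition (Localization.AtPrime 𝔮) (algebraMap A (Localization.AtPrime 𝔮) F))
    (hP00 : ∀ (k₀ : Type) [Field k₀] [CharP k₀ p] [PerfectField k₀]
      (A : Type) [CommRing A] [Algebra k₀ A] [Algebra.FiniteType k₀ A] (𝔪 : Ideal A) [𝔪.IsPrime] (F : A),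
      IsRegularLocalRing (Localization.AtPrime 𝔪) →
      ringKrullDim (Localization.AtPrime 𝔪) = (3 : ℕ) →
      algebraMap A (Localization.AtPrime 𝔪) F ≠ 0 →
      algebraMap A (Localization.AtPrime 𝔪) F ∈ (maximalIdeal (Localization.AtPrime 𝔪)) ^ 2 →
      topStratumPrime iotaOrdEpsTau (Localization.AtPrime 𝔪) (algebraMap A (Localization.AtPrime 𝔪) F) =
        maximalIdeal (Localization.AtPrime 𝔪) →
      iotaEps (Localization.AtPrime 𝔪) (algebraMap A (Localization.AtPrime 𝔪) F) = 0 →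
      iotaTau (Localization.AtPrime 𝔪) (algebraMap A (Localization.AtPrime 𝔪) F) = 0 →
      ∃ h : A, h ∉ 𝔪 ∧ ∃ (N : ℕ) (U : Fin N → A) (W : Fin N → ℕ), (∀ i, 0 < W i) ∧
        (∃ hU : ∀ i, algebraMap A (Localization.AtPrime 𝔪) (U i) ∈ maximalIdeal (Localization.AtPrime 𝔪),
          LinearIndependent (ResidueField (Localization.AtPrime 𝔪))
            (fun i => ((maximalIdeal (Localization.AtPrime 𝔪)).toCotangent ⟨_, hU i⟩ :
              CotangentSpace (Localization.AtPrime 𝔪)))) ∧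
        ∀ (𝔮 : Ideal A) [𝔮.IsPrime], h ∉ 𝔮 → ringKrullDim (Localization.AtPrime 𝔮) ≤ (3 : ℕ) →
          ((∀ i, U i ∈ 𝔮) ↔
            (algebraMap A (Localization.AtPrime 𝔮) F ∈ (maximalIdeal (Localization.AtPrime 𝔮)) ^ 2 ∧
              iotaFlatT (Localization.AtPrime 𝔮) (algebraMap A (Localization.AtPrime 𝔮) F) =
                iotaFlatT (Localization.AtPrime 𝔪) (algebraMap A (Localization.AtPrime 𝔪) F))) ∧
          ((∀ i, U i ∈ 𝔮) → ∀ m : ℕ,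
            jFlatT (Localization.AtPrime 𝔮) (algebraMap A (Localization.AtPrime 𝔮) F) m =
              (weightedMonomialIdeal U W m).map (algebraMap A (Localization.AtPrime 𝔮))))
    (hP01 : ∀ (k₀ : Type) [Field k₀] [CharP k₀ p] [PerfectField k₀]
      (A : Type) [CommRing A] [Algebra k₀ A] [Algebra.FiniteType k₀ A] (𝔪 : Ideal A) [𝔪.IsPrime] (F : A),
      IsRegularLocalRing (Localization.AtPrime 𝔪) →
      ringKrullDim (Localization.AtPrime 𝔪) = (3 : ℕ) →
      algebraMap A (Localization.AtPrime 𝔪) F ≠ 0 →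
      algebraMap A (Localization.AtPrime 𝔪) F ∈ (maximalIdeal (Localization.AtPrime 𝔪)) ^ 2 →
      topStratumPrime iotaOrdEpsTau (Localization.AtPrime 𝔪) (algebraMap A (Localization.AtPrime 𝔪) F) =
        maximalIdeal (Localization.AtPrime 𝔪) →
      iotaEps (Localization.AtPrime 𝔪) (algebraMap A (Localization.AtPrime 𝔪) F) = 0 →
      iotaTau (Localization.AtPrime 𝔪) (algebraMap A (Localization.AtPrime 𝔪) F) = 1 →
      ∃ h : A, h ∉ 𝔪 ∧ ∃ (N : ℕ) (U : Fin N → A) (W : Fin N → ℕ), (∀ i, 0 < W i) ∧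
        (∃ hU : ∀ i, algebraMap A (Localization.AtPrime 𝔪) (U i) ∈ maximalIdeal (Localization.AtPrime 𝔪),
          LinearIndependent (ResidueField (Localization.AtPrime 𝔪))
            (fun i => ((maximalIdeal (Localization.AtPrime 𝔪)).toCotangent ⟨_, hU i⟩ :
              CotangentSpace (Localization.AtPrime 𝔪)))) ∧
        ∀ (𝔮 : Ideal A) [𝔮.IsPrime], h ∉ 𝔮 → ringKrullDim (Localization.AtPrime 𝔮) ≤ (3 : ℕ) →
          ((∀ i, U i ∈ 𝔮) ↔
            (algebraMap A (Localization.AtPrime 𝔮) F ∈ (maximalIdeal (Localization.AtPrime 𝔮)) ^ 2 ∧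
              iotaFlatT (Localization.AtPrime 𝔮) (algebraMap A (Localization.AtPrime 𝔮) F) =
                iotaFlatT (Localization.AtPrime 𝔪) (algebraMap A (Localization.AtPrime 𝔪) F))) ∧
          ((∀ i, U i ∈ 𝔮) → ∀ m : ℕ,
            jFlatT (Localization.AtPrime 𝔮) (algebraMap A (Localization.AtPrime 𝔮) F) m =
              (weightedMonomialIdeal U W m).map (algebraMap A (Localization.AtPrime 𝔮))))
    (hP10 : ∀ (k₀ : Type) [Field k₀] [CharP k₀ p] [PerfectField k₀]
      (A : Type) [CommRing A] [Algebra k₀ A] [Algebra.FiniteType k₀ A] (𝔪 : Ideal A) [𝔪.IsPrime] (F : A),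
      IsRegularLocalRing (Localization.AtPrime 𝔪) →
      ringKrullDim (Localization.AtPrime 𝔪) = (3 : ℕ) →
      algebraMap A (Localization.AtPrime 𝔪) F ≠ 0 →
      algebraMap A (Localization.AtPrime 𝔪) F ∈ (maximalIdeal (Localization.AtPrime 𝔪)) ^ 2 →
      topStratumPrime iotaOrdEpsTau (Localization.AtPrime 𝔪) (algebraMap A (Localization.AtPrime 𝔪) F) =
        maximalIdeal (Localization.AtPrime 𝔪) →
      iotaEps (Localization.AtPrime 𝔪) (algebraMap A (Localization.AtPrime 𝔪) F) = 1 →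
      iotaTau (Localization.AtPrime 𝔪) (algebraMap A (Localization.AtPrime 𝔪) F) = 0 →
      ∃ h : A, h ∉ 𝔪 ∧ ∃ (N : ℕ) (U : Fin N → A) (W : Fin N → ℕ), (∀ i, 0 < W i) ∧
        (∃ hU : ∀ i, algebraMap A (Localization.AtPrime 𝔪) (U i) ∈ maximalIdeal (Localization.AtPrime 𝔪),
          LinearIndependent (ResidueField (Localization.AtPrime 𝔪))
            (fun i => ((maximalIdeal (Localization.AtPrime 𝔪)).toCotangent ⟨_, hU i⟩ :
              CotangentSpace (Localization.AtPrime 𝔪)))) ∧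
        ∀ (𝔮 : Ideal A) [𝔮.IsPrime], h ∉ 𝔮 → ringKrullDim (Localization.AtPrime 𝔮) ≤ (3 : ℕ) →
          ((∀ i, U i ∈ 𝔮) ↔
            (algebraMap A (Localization.AtPrime 𝔮) F ∈ (maximalIdeal (Localization.AtPrime 𝔮)) ^ 2 ∧
              iotaFlatT (Localization.AtPrime 𝔮) (algebraMap A (Localization.AtPrime 𝔮) F) =
                iotaFlatT (Localization.AtPrime 𝔪) (algebraMap A (Localization.AtPrime 𝔪) F))) ∧
          ((∀ i, U i ∈ 𝔮) → ∀ m : ℕ,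
            jFlatT (Localization.AtPrime 𝔮) (algebraMap A (Localization.AtPrime 𝔮) F) m =
              (weightedMonomialIdeal U W m).map (algebraMap A (Localization.AtPrime 𝔮)))) :
    JOpenPresentationForallSingLE 3 p iotaFlatT jFlatT := by
  classical
  intro k₀ _ _ _ A _ _ _ 𝔪 _ F hreg hdim hF0 hF2
  haveI := hreg
  haveI : IsNoetherianRing A := Algebra.FiniteType.isNoetherianRing k₀ A
  haveI := isDomain_of_isRegularLocalRing (Localization.AtPrime 𝔪)
  have hdim3 : ringKrullDim (Localization.AtPrime 𝔪) ≤ 3 := by exact_mod_cast hdim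
  have hf : algebraMap A (Localization.AtPrime 𝔪) F ∈ maximalIdeal (Localization.AtPrime 𝔪) := Ideal.pow_le_self two_ne_zero hF2
  -- the order `ν ≥ 2` and the generic prime `P₀` of the top `ι₀`-stratum
  obtain ⟨-, hfν, hfν1⟩ := EssSmoothLevels.adicOrder_toNat_spec hF0 hf
  have hν : iotaOrd (Localization.AtPrime 𝔪) (algebraMap A (Localization.AtPrime 𝔪) F) =
      ((adicOrder (algebraMap A (Localization.AtPrime 𝔪) F)).toNat : ℕ) := (iotaOrd_eq_natCast_iff _ _ _).mpr ⟨hfν, hfν1⟩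
  have h2 : (2 : Ordinal) ≤ iotaOrd (Localization.AtPrime 𝔪) (algebraMap A (Localization.AtPrime 𝔪) F) :=
    (StratumIff.mem_sq_iff_two_le_iotaOrd F 𝔪).mp hF2
  obtain ⟨hP₀, hregq, hfP₀, hE, hkept, -⟩ := topStratumPrime_iotaOrdEpsTau_spec hdim3 hF0 hf hν
  set P₀ := topStratumPrime iotaOrdEpsTau (Localization.AtPrime 𝔪) (algebraMap A (Localization.AtPrime 𝔪) F) with hP₀def
  haveI := hP₀
  haveI := hregq
  -- generators of `P₀` with independent differentials; `c + e = dim S`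
  have hP₀𝔪 : P₀ ≤ maximalIdeal (Localization.AtPrime 𝔪) := IsLocalRing.le_maximalIdeal hP₀.ne_top
  obtain ⟨c, u, hu₀, hspan, hli⟩ :=
    exists_span_eq_of_isRegularLocalRing_quotient hP₀𝔪 (P₀ : Set (Localization.AtPrime 𝔪)) (Ideal.span_eq P₀)
  have hu : ∀ i, u i ∈ maximalIdeal (Localization.AtPrime 𝔪) := fun i => hP₀𝔪 (hu₀ i)
  have hrs : IsRsopPart u := JFlatEssSmooth.isRsopPart_of_linearIndependent_toCotangent u hu hli
  obtain ⟨dS, hdS⟩ := exists_ringKrullDim_eq_natCast (Localization.AtPrime 𝔪)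
  have hdS3 : dS ≤ 3 := by have := hdS ▸ hdim3; exact_mod_cast this
  obtain ⟨-, e, y, hde, hspan𝔪⟩ := hrs
  have hce : c + e = dS := by
    have := hdS ▸ hde
    exact_mod_cast this.symm
  have hP₀max : e = 0 → P₀ = maximalIdeal (Localization.AtPrime 𝔪) := by
    intro he
    subst he
    rw [← hspan, ← hspan𝔪, Set.range_eq_empty y, Set.union_empty]
  -- the order is kept at `P₀`
  have hordP₀ : iotaOrd (Localization.AtPrime P₀) (algebraMap (Localization.AtPrime 𝔪) (Localization.AtPrime P₀)
      (algebraMap A (Localization.AtPrime 𝔪) F)) = iotaOrd (Localization.AtPrime 𝔪) (algebraMap A (Localization.AtPrime 𝔪) F) := by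
    have h := (hkept P₀ hfP₀).mpr le_rfl
    rw [iotaOrdEpsTau_eq_iff, iotaOrdEps_eq_iff] at h
    exact h.1.1
  -- case analysis on `c = ht P₀`
  rcases (by omega : c = 0 ∨ c = 1 ∨ c = 2 ∨ c = 3 ∨ 4 ≤ c) with rfl | rfl | rfl | rfl | hc4
  · -- `c = 0`: `P₀ = ⊥ ∋ f`, `f = 0`
    exfalso
    rw [← hspan, Set.range_eq_empty u, Ideal.span_empty] at hfP₀
    exact hF0 ((Submodule.mem_bot (Localization.AtPrime 𝔪)).mp hfP₀)
  · -- `c = 1`: MONOMIAL TYPE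
    have hrange : Set.range u = {u 0} := by
      ext a; constructor
      · rintro ⟨i, rfl⟩; rw [Set.mem_singleton_iff, Fin.fin_one_eq_zero i]
      · rintro rfl; exact ⟨0, rfl⟩
    rw [hrange] at hspan
    have hu2 : u 0 ∉ maximalIdeal (Localization.AtPrime 𝔪) ^ 2 :=
      IsRsopPart.not_mem_sq (JFlatEssSmooth.isRsopPart_of_linearIndependent_toCotangent u hu hli) 0
    have hht : P₀.height = 1 := by
      rw [← hspan]
      refine le_antisymm (Ideal.height_span_singleton_le_one fun h => IsLocalRing.notMem_maximalIdeal.mpr h (hu 0)) ?_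
      refine Ideal.one_le_height_span_singleton_of_mem_nonZeroDivisors (mem_nonZeroDivisors_of_ne_zero fun h => hu2 ?_)
      rw [h]; exact Ideal.zero_mem _
    obtain ⟨v, g, n, hv, hg, hg2, hn, hfeq, -⟩ :=
      EquimultipleCentre.exists_eq_unit_mul_pow_of_iotaOrd_localization_eq_of_height_eq_one hF0 P₀ hfP₀ hht hordP₀
    have hn2 : 2 ≤ n := by
      have h := (letters_of_eq_unit_mul_pow (Localization.AtPrime 𝔪) hdim3 hv hg hg2 hn hfeq).1
      rw [h] at h2
      exact_mod_cast h2
    exact jOpenBodyLE3_of_three 𝔪 F (jOpenPresentationLE_body_monomial k₀ A 𝔪 hdim3 F hv hg hg2 hn2 hfeq)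
  · -- `c = 2`: CURVE TYPE — the height-two regime from the presenting pair `(u 0, u 1)`
    have hrange : Set.range u = {u 0, u 1} := by
      ext a; constructor
      · rintro ⟨i, rfl⟩; fin_cases i <;> simp
      · rintro (rfl | rfl) <;> exact ⟨_, rfl⟩
    rw [hrange] at hspan
    haveI hPpr : (Ideal.span {u 0, u 1}).IsPrime := by rw [hspan]; exact hP₀
    have hxg : ∀ i, (![u 0, u 1] : Fin 2 → Localization.AtPrime 𝔪) i ∈ maximalIdeal (Localization.AtPrime 𝔪) :=
      fun i => by fin_cases i <;> exact hu _
    have hli2 : LinearIndependent (ResidueField (Localization.AtPrime 𝔪))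
        (fun i => (maximalIdeal (Localization.AtPrime 𝔪)).toCotangent ⟨(![u 0, u 1] : Fin 2 → _) i, hxg i⟩) := by
      convert hli using 1
      funext i; fin_cases i <;> rfl
    have hrs2 : IsRsopPart u := JFlatEssSmooth.isRsopPart_of_linearIndependent_toCotangent u hu hli
    -- the valuation dichotomy of `S ⧸ P` (a field when `e = 0`, a discrete valuation ring when `e = 1`)
    have hval : ∀ a b : Localization.AtPrime 𝔪, b ∉ Ideal.span {u 0, u 1} →
        ∃ c : Localization.AtPrime 𝔪, a - b * c ∈ Ideal.span {u 0, u 1} ∨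
          (c ∈ maximalIdeal (Localization.AtPrime 𝔪) ∧ b - a * c ∈ Ideal.span {u 0, u 1}) := by
      rcases Nat.eq_zero_or_pos e with he | he
      · intro a b hb
        have hmax : Ideal.span {u 0, u 1} = maximalIdeal (Localization.AtPrime 𝔪) := hspan.trans (hP₀max he)
        rw [hmax] at hb ⊢
        obtain ⟨b', hb'⟩ := (IsLocalRing.notMem_maximalIdeal.mp hb).exists_left_inv
        exact ⟨b' * a, Or.inl (by rw [← mul_assoc, mul_comm b b', hb', one_mul, sub_self]; exact Ideal.zero_mem _)⟩
      · have he1 : e = 1 := by omega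
        have hquot : ringKrullDim (Localization.AtPrime 𝔪 ⧸ Ideal.span {u 0, u 1}) = 1 := by
          have h := IsRsopPart.ringKrullDim_quotient_add hrs2
          rw [hrange, hde, he1] at h
          norm_num at h
          exact JFlatEssSmooth.eq_one_of_add_two_eq h
        intro a b _
        haveI : IsRegularLocalRing (Localization.AtPrime 𝔪 ⧸ Ideal.span {u 0, u 1}) := by rw [hspan]; exact hregq
        exact Descent.dichotomy_of_ringKrullDim_quotient_eq_one (Ideal.span {u 0, u 1}) inferInstance hquot a b
    exact jOpenBody_of_pair p hT k₀ A 𝔪 hreg hdim F hF0 hF2 (u 0) (u 1) hxg hli2 hspan hval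
  · -- `c = 3`: POINT TYPE
    have he : e = 0 := by omega
    have hP₀𝔪' : P₀ = maximalIdeal (Localization.AtPrime 𝔪) := hP₀max he
    have hdS3' : ringKrullDim (Localization.AtPrime 𝔪) = (3 : ℕ) := by rw [hdS, ← hce, he]
    rcases iotaEps_eq_zero_or_eq_one (Localization.AtPrime 𝔪) (algebraMap A (Localization.AtPrime 𝔪) F) with hε | hε <;>
      rcases iotaTau_eq_zero_or_eq_one (Localization.AtPrime 𝔪) (algebraMap A (Localization.AtPrime 𝔪) F) with hτ | hτ
    · exact hP00 k₀ A 𝔪 F hreg hdS3' hF0 hF2 hP₀𝔪' hε hτ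
    · exact hP01 k₀ A 𝔪 F hreg hdS3' hF0 hF2 hP₀𝔪' hε hτ
    · exact hP10 k₀ A 𝔪 F hreg hdS3' hF0 hF2 hP₀𝔪' hε hτ
    · exfalso
      have h0 := iotaTau_eq_zero_of_iotaEps_eq_one hdim3 hε
      rw [hτ] at h0
      exact one_ne_zero h0
  · -- `c ≥ 4`: impossible in dimension `≤ 3`
    exfalso; omega

end JOpenLE3

end Summit.ResolutionOfSingularities.ResolutionOfSingularities.Theorems

end
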